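import Summits.AtomisticToContinuum.Crystallization.Theses.PricedLinkCensus

/-!
# Route PricedLinkCensus — selection and matching-format helpers for the hinge `StackingHinge`
(stmt-AtomisticToContinuum-14238)

`StackingHinge` is `SoftLayerPropagation → ChargeFreeWindows → GSCP`, `GSCP` being the shared hinge
`GroundStatesChargePeriodic` (stmt-AtomisticToContinuum-2911) written out.  The file
`PricedLinkCensusStackingHinge.lean` records that the hinge is a corollary of 2911 and what the two
antecedents deliver (locally-Barlow windows at the fixed relative precision `1/6`, `barlowWindows_ae`).
The planner's foreseen proof of the remaining content is
`StackingHinge ⇐ (StrainToZero) → (WordSelection)`: energy minimality should select (a) strain `→ 0`,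
(b) ONE stacking word of positive upper density at every window length ("König on the finitely
branching word tree"), (c) one common scale; the charged `Q` is then the corresponding periodic
Barlow stacking.  This file proves the parts of that plan that are pure bookkeeping, so that a
future proof only has to supply the geometric/energetic inputs:

* §1 `exists_frequently_mul_le_of_sum`, `exists_branch_frequently_mul_le` — POSITIVE UPPER DENSITY
  IS INHERITED BY SOME CHILD, and the abstract KÖNIG SELECTION: on a finitely branching tree of
  "patterns" (level `k` menus `C k`, restriction maps `π k : C (k+1) → C k`) with site counts
  `f k c N` that refine up to `o(N)` (`f k c N ≤ Σ_{π c' = c} f (k+1) c' N + δ N` eventually, every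
  `δ > 0`), a positive upper density at the root propagates along an infinite branch: there is
  `b : Π k, C k`, `π k (b (k+1)) = b k`, with `∃ ρ_k > 0, ∃ᶠ N, ρ_k N ≤ f k (b k) N` for every `k`.
  This is step (b) of the plan with the geometry abstracted away (the menus are the stacking words
  of length `∼ R_k` once strain and scale are controlled); `natCard_le_sum_fiber_add_natCard` turns
  set-theoretic compatibility of consecutive levels into the numeric refinement hypothesis.
* §2 `exists_gscpMatch_of_rigidMatch` — FORMAT TRANSFER: a two-way `ε`-matching of the
  `R₀`-window of a site `y i` with a rigid-motion image `g '' S` of a point set `S` (the format of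
  `SoftLayerPropagation`'s conclusion) yields the matching format of `GSCP` (a LINEAR isometry `A`,
  a base point `q ∈ S`, comparison with `y i + A (s - q)`) at radius `R ≤ R₀ - ε` and tolerance
  `2 ε`; the base point is the `z ∈ S` matched to `y i` itself and `A = g.linearIsometryEquiv`.
* §3 `frequently_gscpCard_of_rigidCard` (the same transfer under `Nat.card` and `∃ᶠ N`) and
  `rigidCard_of_nat` (it suffices to charge the windows `(R, ε) = (k+1, 1/(k+1))`, `k : ℕ` — the
  discretisation that makes the levels of §1 natural numbers).
* §4 `stackingHinge_of_rigidCharged`, `stackingHinge_of_chargedPeriodicBarlowWord` — CONDITIONAL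
  ASSEMBLIES: `StackingHinge` follows once every sequence of Lennard-Jones ground states charges, in
  the rigid-motion format, ONE periodic configuration — in particular ONE periodic Barlow stacking
  `barlowStacking a c s` (`s` a `p`-periodic word, one scale `(a, c)`), which is a periodic
  configuration by the tree's `barlowPeriodicConfiguration_points`.  The hypothesis of the second
  theorem is exactly "(a) + (b) + (c)" of the plan; nothing here claims it.

All statements are `[folklore]` bookkeeping; no energy estimate is proved in this file.
-/

namespace Summit.AtomisticToContinuum.Crystallization.Theorems

open Summit.AtomisticToContinuum.Crystallization.Theses.PricedLinkCensus
open Literature.MathematicalPhysics.StatisticalMechanics Literature.Geometry.DiscreteGeometry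
open Filter Topology

local notation "𝔼" => EuclideanSpace ℝ (Fin 3)

/-! ### §1 Positive upper density along a finitely branching tree (König selection) -/

/-- **A positive upper density of a finite sum is carried by one summand.**  If
`ρ N ≤ ∑_{c ∈ F} f c N` for infinitely many `N` (`ρ > 0`, `F` finite), then some `c ∈ F` has
`ρ' N ≤ f c N` for infinitely many `N`, for some `ρ' > 0` (indeed `ρ' = ρ / (#F + 1)` works).
Contrapositive: finitely many eventual bounds `f c N < ρ' N` hold simultaneously eventually.
[folklore] -/
theorem exists_frequently_mul_le_of_sum {α : Type*} (F : Finset α) (f : α → ℕ → ℝ) {ρ : ℝ}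
    (hρ : 0 < ρ) (h : ∃ᶠ N : ℕ in atTop, ρ * (N : ℝ) ≤ ∑ c ∈ F, f c N) :
    ∃ c ∈ F, ∃ ρ' : ℝ, 0 < ρ' ∧ ∃ᶠ N : ℕ in atTop, ρ' * (N : ℝ) ≤ f c N := by
  by_contra H
  push Not at H
  have hk : 0 < (F.card : ℝ) + 1 := by positivity
  have hρ' : 0 < ρ / (F.card + 1) := div_pos hρ hk
  have hev : ∀ c ∈ F, ∀ᶠ N : ℕ in atTop, f c N < ρ / (F.card + 1) * N := fun c hc => by
    simpa only [not_frequently, not_le] using H c hc _ hρ'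
  rw [← eventually_all_finset] at hev
  refine h ?_
  filter_upwards [hev, eventually_gt_atTop 0] with N hN hN0
  rw [not_le]
  have hNr : (0 : ℝ) < N := by exact_mod_cast hN0
  have h1 : (F.card : ℝ) * (ρ / (F.card + 1)) < ρ := by
    rw [← mul_div_assoc, div_lt_iff₀ hk]
    nlinarith
  calc ∑ c ∈ F, f c N ≤ ∑ _c ∈ F, ρ / (F.card + 1) * N :=
        Finset.sum_le_sum fun c hc => (hN c hc).le
    _ = (F.card : ℝ) * (ρ / (F.card + 1)) * N := by
        rw [Finset.sum_const, nsmul_eq_mul, mul_assoc]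
    _ < ρ * N := mul_lt_mul_of_pos_right h1 hNr

/-- **König selection with positive upper density.**  Levels `k : ℕ` carry finite menus `C k` of
patterns with restriction maps `π k : C (k + 1) → C k`, and `f k c N` counts (as a real number) the
sites of the `N`-th configuration showing pattern `c` at level `k`.  Assume (root) the level-`0`
patterns together have positive upper density — `ρ N ≤ ∑_c f 0 c N` for infinitely many `N` — and
(refinement up to `o(N)`) for every `k`, `c` and `δ > 0`, eventually in `N`,
`f k c N ≤ ∑_{c' : π k c' = c} f (k + 1) c' N + δ N` (a site with pattern `c` at level `k` has a
pattern refining `c` at level `k + 1`, except for `o(N)` sites).  Then there is an infinite branch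
`b`, `π k (b (k + 1)) = b k`, every node of which has positive upper density:
`∃ ρ_k > 0, ρ_k N ≤ f k (b k) N` for infinitely many `N`.  (Step (b) of the planner's plan for
`StackingHinge`, "König on the finitely-branching word tree", with the geometry abstracted: the
density may decay with `k`, and the infinitely-many-`N` sets may differ from level to level, exactly
as in `GroundStatesChargePeriodic`.) [folklore] -/
theorem exists_branch_frequently_mul_le {C : ℕ → Type*} [∀ k, Fintype (C k)]
    [∀ k, DecidableEq (C k)] (π : ∀ k, C (k + 1) → C k) (f : ∀ k, C k → ℕ → ℝ)
    (hroot : ∃ ρ : ℝ, 0 < ρ ∧ ∃ᶠ N : ℕ in atTop, ρ * (N : ℝ) ≤ ∑ c, f 0 c N)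
    (hstep : ∀ (k : ℕ) (c : C k) (δ : ℝ), 0 < δ → ∀ᶠ N : ℕ in atTop,
      f k c N ≤ (∑ c' ∈ Finset.univ.filter (fun c' : C (k + 1) => π k c' = c), f (k + 1) c' N) +
        δ * N) :
    ∃ b : ∀ k, C k, (∀ k, π k (b (k + 1)) = b k) ∧
      ∀ k, ∃ ρ : ℝ, 0 < ρ ∧ ∃ᶠ N : ℕ in atTop, ρ * (N : ℝ) ≤ f k (b k) N := by
  -- a fat node has a fat child
  have hchild : ∀ (k : ℕ) (c : C k), (∃ ρ : ℝ, 0 < ρ ∧ ∃ᶠ N : ℕ in atTop, ρ * (N : ℝ) ≤ f k c N) →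
      ∃ c' : C (k + 1), π k c' = c ∧
        ∃ ρ : ℝ, 0 < ρ ∧ ∃ᶠ N : ℕ in atTop, ρ * (N : ℝ) ≤ f (k + 1) c' N := by
    rintro k c ⟨ρ, hρ, hfr⟩
    have h2 : ∃ᶠ N : ℕ in atTop, ρ / 2 * (N : ℝ) ≤
        ∑ c' ∈ Finset.univ.filter (fun c' : C (k + 1) => π k c' = c), f (k + 1) c' N := by
      refine (hfr.and_eventually (hstep k c (ρ / 2) (half_pos hρ))).mono ?_
      rintro N ⟨h1, h2⟩
      linarith
    obtain ⟨c', hc', ρ', hρ', hfr'⟩ := exists_frequently_mul_le_of_sum _ _ (half_pos hρ) h2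
    exact ⟨c', (Finset.mem_filter.1 hc').2, ρ', hρ', hfr'⟩
  -- a fat root
  obtain ⟨ρ, hρ, hfr⟩ := hroot
  obtain ⟨c₀, -, hc₀⟩ := exists_frequently_mul_le_of_sum _ _ hρ hfr
  -- the branch, by recursion along fat children
  choose next hnext_eq hnext_fat using hchild
  let b : ∀ k, {c : C k // ∃ ρ : ℝ, 0 < ρ ∧ ∃ᶠ N : ℕ in atTop, ρ * (N : ℝ) ≤ f k c N} := fun k =>
    Nat.rec (motive := fun k => {c : C k // ∃ ρ : ℝ, 0 < ρ ∧ ∃ᶠ N : ℕ in atTop, ρ * (N : ℝ) ≤ f k c N})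
      ⟨c₀, hc₀⟩ (fun k ch => ⟨next k ch.1 ch.2, hnext_fat k ch.1 ch.2⟩) k
  exact ⟨fun k => (b k).1, fun k => hnext_eq k (b k).1 (b k).2, fun k => (b k).2⟩

/-- **The refinement inequality from set-theoretic refinement.**  On a finite index type, if
every site showing the level-`k` pattern `c` and some level-`(k+1)` pattern `c'` has `π c' = c`
(patterns at consecutive levels are compatible — e.g. because a window matched at the finer level
is matched at the coarser one and coarse patterns are unique), then
`#{P c} ≤ ∑_{π c' = c} #{P' c'} + #{P c ∧ no level-(k+1) pattern}`.  Dividing the last term by `N`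
and letting it tend to `0` is the hypothesis `hstep` of `exists_branch_frequently_mul_le`.
[folklore] -/
theorem natCard_le_sum_fiber_add_natCard {ι C C' : Type*} [Finite ι] [Fintype C'] [DecidableEq C]
    (π : C' → C) (P : C → ι → Prop) (P' : C' → ι → Prop) (c : C)
    (hcompat : ∀ i c', P c i → P' c' i → π c' = c) :
    (Nat.card {i // P c i} : ℝ) ≤
      (∑ c' ∈ Finset.univ.filter (fun c' => π c' = c), (Nat.card {i // P' c' i} : ℝ)) +
        Nat.card {i // P c i ∧ ∀ c', ¬ P' c' i} := by
  classical
  -- inject the `c`-sites into (fibres over the children of `c`) ⊕ (pattern-less `c`-sites)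
  let A := Σ c' : {c' // π c' = c}, {i // P' c'.1 i}
  let B := {i // P c i ∧ ∀ c', ¬ P' c' i}
  let F : {i // P c i} → A ⊕ B := fun i =>
    if h : ∃ c', P' c' i.1 then
      Sum.inl ⟨⟨h.choose, hcompat i.1 _ i.2 h.choose_spec⟩, ⟨i.1, h.choose_spec⟩⟩
    else Sum.inr ⟨i.1, i.2, not_exists.1 h⟩
  have hkey : ∀ i, Sum.elim (fun a : A => a.2.1) (fun b : B => b.1) (F i) = i.1 := by
    intro i
    simp only [F]
    split_ifs <;> rfl
  have hF : Function.Injective F := fun i j hij =>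
    Subtype.ext (by rw [← hkey i, ← hkey j, hij])
  have h1 : Nat.card {i // P c i} ≤ Nat.card (A ⊕ B) := Nat.card_le_card_of_injective F hF
  rw [Nat.card_sum, Nat.card_sigma] at h1
  have h2 : ∑ c' : {c' // π c' = c}, Nat.card {i // P' c'.1 i} =
      ∑ c' ∈ Finset.univ.filter (fun c' => π c' = c), Nat.card {i // P' c' i} :=
    (Finset.sum_subtype _ (fun x => by simp) (fun c' => Nat.card {i // P' c' i})).symm
  rw [h2] at h1
  exact_mod_cast h1

/-! ### §2 Format transfer: rigid-motion windows to the matching format of `GSCP` -/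

/-- **Format transfer.**  Let the `R₀`-window of the site `y i` be two-way `ε`-matched with the
rigid-motion image `g '' S` of a point set `S` (`g` an affine isometry): every site within `R₀` of
`y i` is within `ε` of some `g z`, `z ∈ S`, and every `g z` within `R₀` of `y i` is within `ε` of some
site.  Then, with the base point `q ∈ S` matched to `y i` itself and the linear part `A` of `g`,
the window is matched in the format of `GroundStatesChargePeriodic` at every radius `R` with
`R + ε ≤ R₀` and tolerance `2 ε`: every `s ∈ S` within `R` of `q` has a site within `2 ε` of
`y i + A (s - q)`, and every site within `R` of `y i` is within `2 ε` of some `y i + A (s - q)`,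
`s ∈ S`.  (Indeed `y i + A (s - q) = g s + (y i - g q)` is the image configuration translated by at
most `ε`.) [folklore] -/
theorem exists_gscpMatch_of_rigidMatch {ι : Type*} (y : ι → 𝔼) (i : ι) (S : Set 𝔼)
    (g : 𝔼 ≃ᵃⁱ[ℝ] 𝔼) {R R₀ ε : ℝ} (hR : 0 ≤ R) (hε : 0 ≤ ε) (hRR : R + ε ≤ R₀)
    (h₁ : ∀ j, dist (y i) (y j) ≤ R₀ → ∃ z ∈ S, dist (y j) (g z) ≤ ε)
    (h₂ : ∀ z ∈ S, dist (y i) (g z) ≤ R₀ → ∃ j, dist (y j) (g z) ≤ ε) :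
    ∃ q ∈ S,
      (∀ s ∈ S, dist s q ≤ R → ∃ j, dist (y j) (y i + g.linearIsometryEquiv (s - q)) ≤ 2 * ε) ∧
      (∀ j, dist (y j) (y i) ≤ R →
        ∃ s ∈ S, dist (y j) (y i + g.linearIsometryEquiv (s - q)) ≤ 2 * ε) := by
  have hR₀ : 0 ≤ R₀ := by linarith
  obtain ⟨q, hqS, hq⟩ := h₁ i (by rwa [dist_self])
  -- the translated image configuration
  have key : ∀ s, dist (g s) (y i + g.linearIsometryEquiv (s - q)) ≤ ε := fun s => by
    have hlin : g.linearIsometryEquiv (s - q) = g s - g q := by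
      simpa only [vsub_eq_sub] using g.map_vsub s q
    rw [hlin, dist_eq_norm, show g s - (y i + (g s - g q)) = g q - y i by abel, ← dist_eq_norm,
      dist_comm]
    exact hq
  refine ⟨q, hqS, fun s hs hsq => ?_, fun j hj => ?_⟩
  · have hs₀ : dist (y i) (g s) ≤ R₀ :=
      calc dist (y i) (g s) ≤ dist (y i) (g q) + dist (g q) (g s) := dist_triangle _ _ _
        _ ≤ ε + R := add_le_add hq (by rwa [g.dist_map, dist_comm])
        _ ≤ R₀ := by linarith
    obtain ⟨j, hj⟩ := h₂ s hs hs₀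
    exact ⟨j, (dist_triangle _ (g s) _).trans (by linarith [key s])⟩
  · obtain ⟨z, hzS, hz⟩ := h₁ j (by rw [dist_comm]; linarith)
    exact ⟨z, hzS, (dist_triangle _ (g z) _).trans (by linarith [key z])⟩

/-! ### §3 The transfer under `Nat.card` and `∃ᶠ N`; discretisation of `(R, ε)` -/

/-- **Charging in the rigid-motion format implies charging in the `GSCP` format.**  If a point set
`S` is charged by the sequence `x` in the rigid-motion format — for all `R, ε > 0` some `ρ > 0`
with, for infinitely many `N`, at least `ρ N` sites whose `R`-window is two-way `ε`-matched with
some `g '' S` — then it is charged in the format of `GroundStatesChargePeriodic` (linear isometry,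
base point in `S`), with the same densities read at `(R + ε/2, ε/2)`. [folklore] -/
theorem frequently_gscpCard_of_rigidCard (x : (N : ℕ) → Fin N → 𝔼) (S : Set 𝔼)
    (h : ∀ R ε : ℝ, 0 < R → 0 < ε → ∃ ρ : ℝ, 0 < ρ ∧ ∃ᶠ N : ℕ in atTop, ρ * (N : ℝ) ≤
      (Nat.card {i : Fin N // ∃ g : 𝔼 ≃ᵃⁱ[ℝ] 𝔼,
        (∀ j : Fin N, dist (x N i) (x N j) ≤ R → ∃ z ∈ S, dist (x N j) (g z) ≤ ε) ∧
        (∀ z ∈ S, dist (x N i) (g z) ≤ R → ∃ j : Fin N, dist (x N j) (g z) ≤ ε)} : ℝ)) :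
    ∀ R ε : ℝ, 0 < R → 0 < ε → ∃ ρ : ℝ, 0 < ρ ∧ ∃ᶠ N : ℕ in Filter.atTop, ρ * (N : ℝ) ≤
      (Nat.card {i : Fin N // ∃ A : 𝔼 →ₗᵢ[ℝ] 𝔼, ∃ q ∈ S,
        (∀ s ∈ S, dist s q ≤ R → ∃ j : Fin N, dist (x N j) (x N i + A (s - q)) ≤ ε) ∧
        (∀ j : Fin N, dist (x N j) (x N i) ≤ R →
          ∃ s ∈ S, dist (x N j) (x N i + A (s - q)) ≤ ε)} : ℝ) := by
  intro R ε hR hε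
  obtain ⟨ρ, hρ, hfr⟩ := h (R + ε / 2) (ε / 2) (by positivity) (half_pos hε)
  refine ⟨ρ, hρ, hfr.mono fun N hN => hN.trans ?_⟩
  gcongr
  refine Nat.card_le_card_of_injective (Subtype.map id fun i hi => ?_)
    (Subtype.map_injective _ Function.injective_id)
  obtain ⟨g, hg₁, hg₂⟩ := hi
  obtain ⟨q, hqS, H₁, H₂⟩ :=
    exists_gscpMatch_of_rigidMatch (x N) i S g hR.le (half_pos hε).le le_rfl hg₁ hg₂
  have hε2 : (2 : ℝ) * (ε / 2) = ε := by ring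
  simp only [hε2] at H₁ H₂
  refine ⟨g.linearIsometryEquiv.toLinearIsometry, q, hqS, fun s hs hsq => ?_, fun j hj => ?_⟩
  · obtain ⟨j, hj⟩ := H₁ s hs hsq
    exact ⟨j, by simpa only [LinearIsometryEquiv.coe_toLinearIsometry, id_eq] using hj⟩
  · obtain ⟨s, hs, hjs⟩ := H₂ j hj
    exact ⟨s, hs, by simpa only [LinearIsometryEquiv.coe_toLinearIsometry, id_eq] using hjs⟩

/-- **Discretisation of the windows.**  To charge `S` in the rigid-motion format at every
`(R, ε)` it suffices to do so at `(R, ε) = (k + 1, 1/(k + 1))`, `k : ℕ` (matching is monotone: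
a larger radius and a smaller tolerance only help).  This makes the levels of the König selection
`exists_branch_frequently_mul_le` natural numbers. [folklore] -/
theorem rigidCard_of_nat (x : (N : ℕ) → Fin N → 𝔼) (S : Set 𝔼)
    (h : ∀ k : ℕ, ∃ ρ : ℝ, 0 < ρ ∧ ∃ᶠ N : ℕ in atTop, ρ * (N : ℝ) ≤
      (Nat.card {i : Fin N // ∃ g : 𝔼 ≃ᵃⁱ[ℝ] 𝔼,
        (∀ j : Fin N, dist (x N i) (x N j) ≤ (k + 1 : ℝ) →
          ∃ z ∈ S, dist (x N j) (g z) ≤ 1 / (k + 1 : ℝ)) ∧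
        (∀ z ∈ S, dist (x N i) (g z) ≤ (k + 1 : ℝ) →
          ∃ j : Fin N, dist (x N j) (g z) ≤ 1 / (k + 1 : ℝ))} : ℝ)) :
    ∀ R ε : ℝ, 0 < R → 0 < ε → ∃ ρ : ℝ, 0 < ρ ∧ ∃ᶠ N : ℕ in atTop, ρ * (N : ℝ) ≤
      (Nat.card {i : Fin N // ∃ g : 𝔼 ≃ᵃⁱ[ℝ] 𝔼,
        (∀ j : Fin N, dist (x N i) (x N j) ≤ R → ∃ z ∈ S, dist (x N j) (g z) ≤ ε) ∧
        (∀ z ∈ S, dist (x N i) (g z) ≤ R → ∃ j : Fin N, dist (x N j) (g z) ≤ ε)} : ℝ) := by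
  intro R ε hR hε
  obtain ⟨k, hk⟩ := exists_nat_ge (max R (1 / ε))
  have hkR : R ≤ (k + 1 : ℝ) := ((le_max_left _ _).trans hk).trans (by linarith)
  have hk1 : 1 / ε ≤ (k + 1 : ℝ) := ((le_max_right _ _).trans hk).trans (by linarith)
  have hkε : 1 / (k + 1 : ℝ) ≤ ε := by
    rw [div_le_iff₀ (by positivity)]
    rw [div_le_iff₀ hε] at hk1
    linarith
  obtain ⟨ρ, hρ, hfr⟩ := h k
  refine ⟨ρ, hρ, hfr.mono fun N hN => hN.trans ?_⟩
  gcongr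
  refine Nat.card_le_card_of_injective (Subtype.map id fun i hi => ?_)
    (Subtype.map_injective _ Function.injective_id)
  obtain ⟨g, hg₁, hg₂⟩ := hi
  refine ⟨g, fun j hj => ?_, fun z hz hzR => ?_⟩
  · obtain ⟨z, hzS, hz⟩ := hg₁ j (hj.trans hkR)
    exact ⟨z, hzS, hz.trans hkε⟩
  · obtain ⟨j, hj⟩ := hg₂ z hz (hzR.trans hkR)
    exact ⟨j, hj.trans hkε⟩

/-! ### §4 Conditional assemblies of the hinge -/

/-- **`StackingHinge` from charging in the rigid-motion format.**  If every sequence of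
Lennard-Jones ground states charges ONE periodic configuration `Q` in the rigid-motion format
(for all `R, ε > 0`: some `ρ > 0` and infinitely many `N` with at least `ρ N` sites whose
`R`-window is two-way `ε`-matched with a rigid-motion image of `Q.points`), then `StackingHinge`
holds (its two antecedents are not needed for this implication).  By
`frequently_gscpCard_of_rigidCard`. [folklore] -/
theorem stackingHinge_of_rigidCharged
    (h : ∀ x : (N : ℕ) → (Fin N → 𝔼), (∀ N, IsGroundState lennardJones (x N)) →
      ∃ Q : PeriodicConfiguration 3, ∀ R ε : ℝ, 0 < R → 0 < ε → ∃ ρ : ℝ, 0 < ρ ∧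
        ∃ᶠ N : ℕ in atTop, ρ * (N : ℝ) ≤ (Nat.card {i : Fin N // ∃ g : 𝔼 ≃ᵃⁱ[ℝ] 𝔼,
          (∀ j : Fin N, dist (x N i) (x N j) ≤ R → ∃ z ∈ Q.points, dist (x N j) (g z) ≤ ε) ∧
          (∀ z ∈ Q.points, dist (x N i) (g z) ≤ R → ∃ j : Fin N, dist (x N j) (g z) ≤ ε)} : ℝ)) :
    StackingHinge := by
  intro _ _ x hx
  obtain ⟨Q, hQ⟩ := h x hx
  exact ⟨Q, frequently_gscpCard_of_rigidCard x Q.points hQ⟩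

/-- **`StackingHinge` from ONE charged periodic Barlow word at ONE scale** — the conjunction of
the three selections (a) strain `→ 0`, (b) one periodic stacking word, (c) one common scale that
the planner's plan asks energy minimality to deliver: if for every sequence of Lennard-Jones
ground states there are an in-layer spacing `a ≠ 0`, a layer spacing `c ≠ 0` and a `p`-periodic
word `s` (`p ≠ 0`) such that the exact Barlow stacking `barlowStacking a c s` is charged in the
rigid-motion format with positive upper density at every window `(R, ε)`, then `StackingHinge`
holds — the charged periodic configuration is `barlowPeriodicConfiguration s _ _ _ _`, whose point
set is the stacking (`barlowPeriodicConfiguration_points`).  Nothing in this file proves the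
hypothesis. [folklore] -/
theorem stackingHinge_of_chargedPeriodicBarlowWord
    (h : ∀ x : (N : ℕ) → (Fin N → 𝔼), (∀ N, IsGroundState lennardJones (x N)) →
      ∃ (a c : ℝ) (p : ℕ) (s : ℤ → ℤ), a ≠ 0 ∧ c ≠ 0 ∧ p ≠ 0 ∧ (∀ m, s (m + p) = s m) ∧
        ∀ R ε : ℝ, 0 < R → 0 < ε → ∃ ρ : ℝ, 0 < ρ ∧
        ∃ᶠ N : ℕ in atTop, ρ * (N : ℝ) ≤ (Nat.card {i : Fin N // ∃ g : 𝔼 ≃ᵃⁱ[ℝ] 𝔼,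
          (∀ j : Fin N, dist (x N i) (x N j) ≤ R →
            ∃ z ∈ barlowStacking a c s, dist (x N j) (g z) ≤ ε) ∧
          (∀ z ∈ barlowStacking a c s, dist (x N i) (g z) ≤ R →
            ∃ j : Fin N, dist (x N j) (g z) ≤ ε)} : ℝ)) :
    StackingHinge := by
  refine stackingHinge_of_rigidCharged fun x hx => ?_
  obtain ⟨a, c, p, s, ha, hc, hp, hs, H⟩ := h x hx
  refine ⟨barlowPeriodicConfiguration s ha hc hp hs, ?_⟩
  rw [barlowPeriodicConfiguration_points]
  exact H

end Summit.AtomisticToContinuum.Crystallization.Theorems
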